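import Literature.MathematicalPhysics.QuantumLattice.SpectroscopicGapRatio
import HarnessLib

/-!
# STM gap-map statistics of the Bi-based cuprates: the printed means, widths and local gap-closing ratios `[float]`

Topic `MathematicalPhysics/QuantumLattice` (family `hubbard`; cell `hubbard-downfold`, seat lit-2; companion of
REFVALS-2 §157).  This file records, as `[float]` DATA with locators (definitions of real numbers, asserting
nothing about any Hamiltonian), what three scanning-tunnelling-spectroscopy studies PRINT IN TEXT / IN TABLES
about the spatial statistics of the gap `Δ(r)` in Bi₂Sr₂CaCu₂O₈₊δ (validation id M33 at optimal doping) and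
(Pb-)Bi₂Sr₂CuO₆₊ₓ (M61 / M62 class), and certifies the exact arithmetic REFVALS-2 §157 performs on them:

* K. McElroy, D.-H. Lee, J. E. Hoffman, K. M. Lang, J. Lee, E. W. Hudson, H. Eisaki, S. Uchida, J. C. Davis,
  Phys. Rev. Lett. 94 (2005) 197005 (`McElroyEtAl2005Bi2212CheckerboardGapMaps`; arXiv:cond-mat/0406491,
  Table I): per sample `T_c`, hole density `p (%)`, mean gap `Δ̄`, full width at half maximum `σ` of the gap
  histogram;
* K. K. Gomes, A. N. Pasupathy, A. Pushp, S. Ono, Y. Ando, A. Yazdani, Nature 447 (2007) 569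
  (`GomesEtAl2007Bi2212PairFormation`; arXiv:0706.0214): the local gap-closing criterion `2Δ/k_BT_p`;
* M. C. Boyer, W. D. Wise, K. Chatterjee, M. Yi, T. Kondo, T. Takeuchi, H. Ikuta, E. W. Hudson, Nature Phys. 3
  (2007) 802 (`BoyerEtAl2007PbBi2201TwoGaps`; arXiv:0705.1731): the two gaps of overdoped Pb-Bi2201.

The ratio map `tunnellingGapRatio Δ T = 2Δ/(k_B T)` and the exact SI `k_B` are REUSED from
`SpectroscopicGapRatio.lean`; nothing is re-declared.  Every theorem is `norm_num` arithmetic on printed numbers.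
* J. W. Alldredge, J. Lee, K. McElroy, M. Wang, K. Fujita, Y. Kohsaka, C. Taylor, H. Eisaki, S. Uchida,
  P. J. Hirschfeld, J. C. Davis, Nature Phys. 4 (2008) 319 (`AlldredgeEtAl2008Bi2212GapEdgeScattering`;
  arXiv:0801.0087): the printed `(Δ₁, Γ₂*)` table of gap-sorted spectra and the doping formula (§4).

No named facts.
-/

noncomputable section

namespace Literature.MathematicalPhysics.QuantumLattice.GapMapStatistics


/-! ## §1 McElroy et al. 2005, Table I (Bi₂Sr₂CaCu₂O₈₊δ gap maps by doping) -/

/-- `T_c` (K) of the three samples with a printed mean gap: «89K OD», «79K UD», «75K UD» (the fourth, «65K UD», has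
`Δ̄ > 62 meV`, `σ` «unclear») [cite: McElroyEtAl2005Bi2212CheckerboardGapMaps, Table I]. -/
def mceTc : Fin 3 → ℝ := ![89, 79, 75]

/-- Hole density `p` in % («19 ± 1», «15 ± 1», «13 ± 1»; «11 ± 1» for 65K UD)
[cite: McElroyEtAl2005Bi2212CheckerboardGapMaps, Table I]. -/
def mceP : Fin 3 → ℝ := ![19, 15, 13]

/-- Mean gap `Δ̄` in meV («33 ± 1», «43 ± 1», «48 ± 1») [cite: McElroyEtAl2005Bi2212CheckerboardGapMaps, Table I]. -/
def mceGap : Fin 3 → ℝ := ![33, 43, 48]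

/-- Gap-histogram width `σ` (FWHM, meV): «7», «9», «10» [cite: McElroyEtAl2005Bi2212CheckerboardGapMaps, Table I]. -/
def mceSigma : Fin 3 → ℝ := ![7, 9, 10]

/-- Value lemma [cite: McElroyEtAl2005Bi2212CheckerboardGapMaps, Table I]. -/
@[simp] theorem mceTc_v0 : mceTc 0 = 89 := by simp [mceTc]
/-- Value lemma [cite: McElroyEtAl2005Bi2212CheckerboardGapMaps, Table I]. -/
@[simp] theorem mceTc_v1 : mceTc 1 = 79 := by simp [mceTc]
/-- Value lemma [cite: McElroyEtAl2005Bi2212CheckerboardGapMaps, Table I]. -/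
@[simp] theorem mceTc_v2 : mceTc 2 = 75 := by simp [mceTc]
/-- Value lemma [cite: McElroyEtAl2005Bi2212CheckerboardGapMaps, Table I]. -/
@[simp] theorem mceP_v0 : mceP 0 = 19 := by simp [mceP]
/-- Value lemma [cite: McElroyEtAl2005Bi2212CheckerboardGapMaps, Table I]. -/
@[simp] theorem mceP_v1 : mceP 1 = 15 := by simp [mceP]
/-- Value lemma [cite: McElroyEtAl2005Bi2212CheckerboardGapMaps, Table I]. -/
@[simp] theorem mceP_v2 : mceP 2 = 13 := by simp [mceP]
/-- Value lemma [cite: McElroyEtAl2005Bi2212CheckerboardGapMaps, Table I]. -/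
@[simp] theorem mceGap_v0 : mceGap 0 = 33 := by simp [mceGap]
/-- Value lemma [cite: McElroyEtAl2005Bi2212CheckerboardGapMaps, Table I]. -/
@[simp] theorem mceGap_v1 : mceGap 1 = 43 := by simp [mceGap]
/-- Value lemma [cite: McElroyEtAl2005Bi2212CheckerboardGapMaps, Table I]. -/
@[simp] theorem mceGap_v2 : mceGap 2 = 48 := by simp [mceGap]
/-- Value lemma [cite: McElroyEtAl2005Bi2212CheckerboardGapMaps, Table I]. -/
@[simp] theorem mceSigma_v0 : mceSigma 0 = 7 := by simp [mceSigma]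
/-- Value lemma [cite: McElroyEtAl2005Bi2212CheckerboardGapMaps, Table I]. -/
@[simp] theorem mceSigma_v1 : mceSigma 1 = 9 := by simp [mceSigma]
/-- Value lemma [cite: McElroyEtAl2005Bi2212CheckerboardGapMaps, Table I]. -/
@[simp] theorem mceSigma_v2 : mceSigma 2 = 10 := by simp [mceSigma]

/-- THE RELATIVE WIDTH IS DOPING-INDEPENDENT on the printed digits: `σ/Δ̄ = 7/33 ∈ (0.2121, 0.2122)`,
`9/43 ∈ (0.2093, 0.2094)`, `10/48 ∈ (0.2083, 0.2084)` — all in `[0.208, 0.213]` (the statement «the width of any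
given gap distribution at low temperature scales with its mean value» of [GomesEtAl2007Bi2212PairFormation, SI §3]
read on McElroy's table) [cite: McElroyEtAl2005Bi2212CheckerboardGapMaps, Table I]. -/
theorem mce_relative_width_rows :
    (0.2121 < mceSigma 0 / mceGap 0 ∧ mceSigma 0 / mceGap 0 < 0.2122) ∧
    (0.2093 < mceSigma 1 / mceGap 1 ∧ mceSigma 1 / mceGap 1 < 0.2094) ∧
    (0.2083 < mceSigma 2 / mceGap 2 ∧ mceSigma 2 / mceGap 2 < 0.2084) ∧
    (∀ i, 0.208 ≤ mceSigma i / mceGap i ∧ mceSigma i / mceGap i ≤ 0.213) := by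
  refine ⟨by simp; norm_num, by simp; norm_num, by simp; norm_num, ?_⟩
  intro i; fin_cases i <;> simp <;> norm_num

/-- THE MEAN GAP vs HOLE DENSITY is exactly linear on the three printed rows: slope `(48 − 33)/(13 − 19) =
(43 − 33)/(15 − 19) = (48 − 43)/(13 − 15) = −2.5 meV per % of holes`; extrapolated to «11 %» it gives `53`, below
the printed «> 62» of the 65K UD sample (the line under-predicts the deep-underdoped mean)
[cite: McElroyEtAl2005Bi2212CheckerboardGapMaps, Table I]. -/
theorem mce_gap_vs_p_rows :
    (mceGap 2 - mceGap 0) / (mceP 2 - mceP 0) = -2.5 ∧ (mceGap 1 - mceGap 0) / (mceP 1 - mceP 0) = -2.5 ∧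
    (mceGap 2 - mceGap 1) / (mceP 2 - mceP 1) = -2.5 ∧ mceGap 2 + (-2.5) * (11 - mceP 2) = 53 ∧ (53 : ℝ) < 62 := by
  simp; norm_num

/-- `2Δ̄/k_BT_c` of the MAP MEAN by sample (exact SI `k_B`): `∈ (8.605, 8.606)` (89K OD), `(12.632, 12.633)` (79K UD),
`(14.853, 14.854)` (75K UD), and `> 22.13` for the 65K UD bound `Δ̄ > 62` — the map mean outruns `T_c` on
underdoping [cite: McElroyEtAl2005Bi2212CheckerboardGapMaps, Table I] [cite: BIPM2019, Table 1]. -/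
theorem mce_mean_ratio_rows :
    (8.605 < tunnellingGapRatio (mceGap 0) (mceTc 0) ∧ tunnellingGapRatio (mceGap 0) (mceTc 0) < 8.606) ∧
    (12.632 < tunnellingGapRatio (mceGap 1) (mceTc 1) ∧ tunnellingGapRatio (mceGap 1) (mceTc 1) < 12.633) ∧
    (14.853 < tunnellingGapRatio (mceGap 2) (mceTc 2) ∧ tunnellingGapRatio (mceGap 2) (mceTc 2) < 14.854) ∧
    22.13 < tunnellingGapRatio 62 65 := by
  simp only [mceGap_v0, mceGap_v1, mceGap_v2, mceTc_v0, mceTc_v1, mceTc_v2]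
  refine ⟨⟨?_, ?_⟩, ⟨?_, ?_⟩, ⟨?_, ?_⟩, ?_⟩ <;>
    norm_num [tunnellingGapRatio, kBmeVPerKelvin, boltzmannSI, elementaryChargeSI_def]

/-! ## §2 Gomes et al. 2007: the local gap-closing criterion -/

/-- «The best-fit ratio extracted in Fig. 2f is 2Δ/k_BT_p = 7.8 ± 0.3» (OV65, `T_c = 65 K`)
[cite: GomesEtAl2007Bi2212PairFormation, p. 2]. -/
def gomesLocalRatio : ℝ := 7.8

/-- Its printed uncertainty [cite: GomesEtAl2007Bi2212PairFormation, p. 2]. -/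
def gomesLocalRatioErr : ℝ := 0.3

/-- The single-site reading behind the criterion: «the maximum value of the local gap Δ ≈ 24 meV … the temperature
T_p ≈ 72–80 K at which Δ is no longer measurable … 2Δ/k_BT_p ≈ 7.7»: on the exact `k_B`, `2·24/(k_B·72) ∈ (7.736,
7.737)` and `2·24/(k_B·80) ∈ (6.962, 6.963)` — the printed `7.7` is the `T_p = 72 K` end
[cite: GomesEtAl2007Bi2212PairFormation, p. 1] [cite: BIPM2019, Table 1]. -/
theorem gomes_site_rows :
    (7.736 < tunnellingGapRatio 24 72 ∧ tunnellingGapRatio 24 72 < 7.737) ∧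
    (6.962 < tunnellingGapRatio 24 80 ∧ tunnellingGapRatio 24 80 < 6.963) := by
  refine ⟨⟨?_, ?_⟩, ⟨?_, ?_⟩⟩ <;> norm_num [tunnellingGapRatio, kBmeVPerKelvin, boltzmannSI, elementaryChargeSI_def]

/-- THE GAPS IMPLIED BY THE CRITERION on the printed `T_p` windows (`Δ = 7.8·k_B·T_p/2`): OV65 «64–80 K» ↦
`Δ ∈ (21.50, 26.89) meV` and OP93 «105–160 K» ↦ `(35.28, 53.78) meV`; `T_p/T_c` windows `64/65 ∈ (0.984, 0.985)` to
`80/65 ∈ (1.230, 1.231)` (OV65) and `105/93 ∈ (1.129, 1.130)` to `160/93 ∈ (1.720, 1.721)` (OP93)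
[cite: GomesEtAl2007Bi2212PairFormation, pp. 1–2] [cite: BIPM2019, Table 1]. -/
theorem gomes_implied_gap_rows :
    (21.50 < gomesLocalRatio * kBmeVPerKelvin * 64 / 2 ∧ gomesLocalRatio * kBmeVPerKelvin * 64 / 2 < 21.51) ∧
    (26.88 < gomesLocalRatio * kBmeVPerKelvin * 80 / 2 ∧ gomesLocalRatio * kBmeVPerKelvin * 80 / 2 < 26.89) ∧
    (35.28 < gomesLocalRatio * kBmeVPerKelvin * 105 / 2 ∧ gomesLocalRatio * kBmeVPerKelvin * 105 / 2 < 35.29) ∧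
    (53.77 < gomesLocalRatio * kBmeVPerKelvin * 160 / 2 ∧ gomesLocalRatio * kBmeVPerKelvin * 160 / 2 < 53.78) ∧
    ((0.984 < (64 : ℝ) / 65 ∧ (64 : ℝ) / 65 < 0.985) ∧ (1.230 < (80 : ℝ) / 65 ∧ (80 : ℝ) / 65 < 1.231)) ∧
    ((1.129 < (105 : ℝ) / 93 ∧ (105 : ℝ) / 93 < 1.130) ∧ (1.720 < (160 : ℝ) / 93 ∧ (160 : ℝ) / 93 < 1.721)) := by
  refine ⟨⟨?_, ?_⟩, ⟨?_, ?_⟩, ⟨?_, ?_⟩, ⟨?_, ?_⟩, by norm_num, by norm_num⟩ <;>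
    norm_num [gomesLocalRatio, kBmeVPerKelvin, boltzmannSI, elementaryChargeSI_def]

/-- McElroy's MAP-MEAN ratios against Gomes's LOCAL criterion: the 89K OD mean ratio `8.61` exceeds `7.8 + 0.3 = 8.1`
by `< 0.51`; the underdoped means (`12.6`, `14.9`) exceed it by factors `∈ (1.55, 1.57)` and `(1.83, 1.84)` — two
different constructions (histogram mean over `T_c` vs per-site gap over its own `T_p`), numbers side by side
[cite: McElroyEtAl2005Bi2212CheckerboardGapMaps, Table I] [cite: GomesEtAl2007Bi2212PairFormation, p. 2]. -/
theorem mce_vs_gomes_rows :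
    gomesLocalRatio + gomesLocalRatioErr = 8.1 ∧
    tunnellingGapRatio (mceGap 0) (mceTc 0) - (gomesLocalRatio + gomesLocalRatioErr) < 0.51 ∧
    (1.55 < tunnellingGapRatio (mceGap 1) (mceTc 1) / (gomesLocalRatio + gomesLocalRatioErr) ∧
      tunnellingGapRatio (mceGap 1) (mceTc 1) / (gomesLocalRatio + gomesLocalRatioErr) < 1.57) ∧
    (1.83 < tunnellingGapRatio (mceGap 2) (mceTc 2) / (gomesLocalRatio + gomesLocalRatioErr) ∧
      tunnellingGapRatio (mceGap 2) (mceTc 2) / (gomesLocalRatio + gomesLocalRatioErr) < 1.84) := by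
  simp only [mceGap_v0, mceGap_v1, mceGap_v2, mceTc_v0, mceTc_v1, mceTc_v2]
  refine ⟨?_, ?_, ⟨?_, ?_⟩, ⟨?_, ?_⟩⟩ <;>
    norm_num [tunnellingGapRatio, gomesLocalRatio, gomesLocalRatioErr, kBmeVPerKelvin, boltzmannSI,
      elementaryChargeSI_def]

/-! ## §3 Boyer et al. 2007: the two gaps of overdoped Pb-Bi₂Sr₂CuO₆₊ₓ (`T_c = 15 K`) -/

/-- The inhomogeneous, temperature-independent large gap: «Δ_large = 16 ± 8 meV» (mean ± standard deviation of the map)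
[cite: BoyerEtAl2007PbBi2201TwoGaps, p. 3]. -/
def boyerLarge : ℝ := 16
/-- Its map standard deviation [cite: BoyerEtAl2007PbBi2201TwoGaps, p. 3]. -/
def boyerLargeSD : ℝ := 8
/-- The homogeneous small gap that vanishes near `T_c`: «Δ_small = 6.7 ± 1.6 meV» [cite: BoyerEtAl2007PbBi2201TwoGaps, p. 3]. -/
def boyerSmall : ℝ := 6.7
/-- Its map standard deviation [cite: BoyerEtAl2007PbBi2201TwoGaps, p. 3]. -/
def boyerSmallSD : ℝ := 1.6
/-- The sample `T_c = 15 K` (normalisation temperature `T_N = 17 K`) [cite: BoyerEtAl2007PbBi2201TwoGaps, pp. 2–3]. -/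
def boyerTc : ℝ := 15

/-- Relative widths `8/16 = 0.5` (large) vs `1.6/6.7 ∈ (0.2388, 0.2389)` (small) — the small gap's relative width is
the Bi2212 class value `≈ 0.21–0.24`, the large gap's twice it; ratio of means `16/6.7 ∈ (2.388, 2.389)`; `2Δ/k_BT_c`
on the exact `k_B`: small `∈ (10.366, 10.367)` (bar `(7.891, 12.843)` from `6.7 ∓ 1.6`), large `∈ (24.756, 24.757)`
[cite: BoyerEtAl2007PbBi2201TwoGaps, p. 3] [cite: BIPM2019, Table 1]. -/
theorem boyer_rows :
    boyerLargeSD / boyerLarge = 0.5 ∧ (0.2388 < boyerSmallSD / boyerSmall ∧ boyerSmallSD / boyerSmall < 0.2389) ∧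
    (2.388 < boyerLarge / boyerSmall ∧ boyerLarge / boyerSmall < 2.389) ∧
    (10.366 < tunnellingGapRatio boyerSmall boyerTc ∧ tunnellingGapRatio boyerSmall boyerTc < 10.367) ∧
    (7.891 < tunnellingGapRatio (boyerSmall - boyerSmallSD) boyerTc ∧
      tunnellingGapRatio (boyerSmall + boyerSmallSD) boyerTc < 12.843) ∧
    (24.756 < tunnellingGapRatio boyerLarge boyerTc ∧ tunnellingGapRatio boyerLarge boyerTc < 24.757) := by
  refine ⟨?_, ⟨?_, ?_⟩, ⟨?_, ?_⟩, ⟨?_, ?_⟩, ⟨?_, ?_⟩, ⟨?_, ?_⟩⟩ <;>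
    norm_num [boyerLarge, boyerLargeSD, boyerSmall, boyerSmallSD, boyerTc, tunnellingGapRatio, kBmeVPerKelvin,
      boltzmannSI, elementaryChargeSI_def]

/-- Gomes's local criterion read on Boyer's small gap: `2·6.7/k_BT_c = 10.37 > 8.1` at `T_c`; the `T_p` at which a
`6.7 meV` gap would close under `2Δ/k_BT_p = 7.8` is `2·6.7/(7.8·k_B) ∈ (19.93, 19.94) K`, above `T_c = 15 K` and the
normalisation temperature `17 K` — numbers side by side, materials differ (single- vs double-layer)
[cite: BoyerEtAl2007PbBi2201TwoGaps, p. 3] [cite: GomesEtAl2007Bi2212PairFormation, p. 2] [cite: BIPM2019, Table 1]. -/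
theorem boyer_vs_gomes_rows :
    gomesLocalRatio + gomesLocalRatioErr < tunnellingGapRatio boyerSmall boyerTc ∧
    (19.93 < 2 * boyerSmall / (gomesLocalRatio * kBmeVPerKelvin) ∧
      2 * boyerSmall / (gomesLocalRatio * kBmeVPerKelvin) < 19.94) ∧ boyerTc < 17 ∧ (17 : ℝ) < 19.93 := by
  refine ⟨?_, ⟨?_, ?_⟩, ?_, ?_⟩ <;>
    norm_num [boyerSmall, boyerTc, gomesLocalRatio, gomesLocalRatioErr, tunnellingGapRatio, kBmeVPerKelvin,
      boltzmannSI, elementaryChargeSI_def]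

/-! ## §4 Alldredge et al. 2008: the gap-edge scattering rate `Γ₂*` against the gap `Δ₁` (REFVALS-2 §157.5) -/

/-- The printed two-column table of the `Δ₁`-sorted average spectra of one `p = 0.10` sample, fitted by the
`Γ₂(E) = αE` d-wave form: `Δ₁` (meV) [cite: AlldredgeEtAl2008Bi2212GapEdgeScattering, Fig. 2 (inset table;
«The Δ1 ranges from 38mV to 93mV while Γ2* spans from below 1meV to above 25meV») and Supplementary Fig. 3 table]. -/
def allDelta : Fin 17 → ℝ := ![14, 18, 22, 28, 33, 38, 43, 48, 53, 57, 62, 67, 72, 77, 82, 87, 92]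

/-- `Γ₂* = Γ₂(E = Δ₁)` (meV) in the same row order
[cite: AlldredgeEtAl2008Bi2212GapEdgeScattering, Fig. 2 and Supplementary Fig. 3 tables]. -/
def allGamma : Fin 17 → ℝ :=
  ![0.08, 0.15, 0.55, 0.01, 0.09, 0.92, 2.2, 3.7, 5.2, 7.3, 10.4, 13.7, 17.1, 19.5, 21.7, 25.4, 30.0]

/-- The dopings of the five mapped samples «calculated from the T_c's of the samples using the formula
T_c = 95 K × (1 − 82.6 (p − 0.16)²)»: `0.22, 0.19, 0.17, 0.14, 0.10 (± 0.01)` (a sixth at `p ∼ 0.08` unfittable)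
[cite: AlldredgeEtAl2008Bi2212GapEdgeScattering, Fig. 3 caption]. -/
def allDopings : Fin 5 → ℝ := ![0.22, 0.19, 0.17, 0.14, 0.10]

/-- READINGS OF THE TABLE (exact on printed digits): below `Δ₁ = 38 meV` every `Γ₂* < 1 meV` and `Γ₂*/Δ₁ ≤ 0.025`;
from `Δ₁ = 28` on the column is strictly increasing; the ratio `Γ₂*/Δ₁` climbs `0.0242 (38) → 0.0512 (43) → 0.1677
(62) → 0.2045 (67) → 0.3261 (92)` (brackets below); mean slope `(30.0 − 0.92)/(92 − 38) ∈ (0.5385, 0.5386)` meV per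
meV; at McElroy's coherence-peak-loss threshold «Δ ≮ 65 meV» the table's neighbours read `Γ₂* = 10.4 (62)` and
`13.7 (67)` meV, i.e. `Γ₂*/Δ₁ ∈ (0.167, 0.205)` [cite: AlldredgeEtAl2008Bi2212GapEdgeScattering, Fig. 2 table]
[cite: McElroyEtAl2005Bi2212CheckerboardGapMaps, p. 2]. -/
theorem alldredge_table_rows :
    (∀ i : Fin 17, allDelta i < 38 → allGamma i < 1 ∧ allGamma i / allDelta i ≤ 0.025) ∧
    (∀ i : Fin 16, 3 ≤ (i : ℕ) → allGamma (Fin.castSucc i) < allGamma i.succ) ∧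
    (0.0242 < allGamma 5 / allDelta 5 ∧ allGamma 5 / allDelta 5 < 0.0243) ∧
    (0.0511 < allGamma 6 / allDelta 6 ∧ allGamma 6 / allDelta 6 < 0.0512) ∧
    (0.1677 < allGamma 10 / allDelta 10 ∧ allGamma 10 / allDelta 10 < 0.1678) ∧
    (0.2044 < allGamma 11 / allDelta 11 ∧ allGamma 11 / allDelta 11 < 0.2045) ∧
    (0.3260 < allGamma 16 / allDelta 16 ∧ allGamma 16 / allDelta 16 < 0.3261) ∧
    (0.5385 < (allGamma 16 - allGamma 5) / (allDelta 16 - allDelta 5) ∧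
      (allGamma 16 - allGamma 5) / (allDelta 16 - allDelta 5) < 0.5386) ∧
    (allDelta 10 < 65 ∧ (65 : ℝ) < allDelta 11 ∧ allGamma 10 = 10.4 ∧ allGamma 11 = 13.7) := by
  refine ⟨?_, ?_, ?_, ?_, ?_, ?_, ?_, ?_, ?_⟩
  · intro i; fin_cases i <;> simp [allDelta, allGamma] <;> norm_num
  · intro i hi; fin_cases i <;> simp at hi <;> simp [allGamma, Fin.castSucc, Fin.succ] <;> norm_num
  all_goals simp [allDelta, allGamma]; norm_num

/-- The scattering rate against the thermal scale: `Γ₂*` crosses `k_BT_c` of the optimal sample (`95 K`: `k_B·95 ∈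
(8.186, 8.187) meV`) between the `Δ₁ = 57` (`7.3`) and `62` (`10.4`) rows, and reaches `3.66 × k_B·95` at `Δ₁ = 92`
[cite: AlldredgeEtAl2008Bi2212GapEdgeScattering, Fig. 2 table] [cite: BIPM2019, Table 1]. -/
theorem alldredge_vs_thermal_rows :
    (8.186 < kBmeVPerKelvin * 95 ∧ kBmeVPerKelvin * 95 < 8.187) ∧
    allGamma 9 < kBmeVPerKelvin * 95 ∧ kBmeVPerKelvin * 95 < allGamma 10 ∧
    (3.66 < allGamma 16 / (kBmeVPerKelvin * 95) ∧ allGamma 16 / (kBmeVPerKelvin * 95) < 3.67) := by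
  have h9 : allGamma 9 = 7.3 := by simp [allGamma]
  have h10 : allGamma 10 = 10.4 := by simp [allGamma]
  have h16 : allGamma 16 = 30 := by simp [allGamma]; norm_num
  rw [h9, h10, h16]
  refine ⟨⟨?_, ?_⟩, ?_, ?_, ⟨?_, ?_⟩⟩ <;>
    norm_num [kBmeVPerKelvin, boltzmannSI, elementaryChargeSI_def]

/-- The printed doping formula is the Presland–Tallon parabola with `T_c,max = 95 K`: at the five printed `p` it
returns `T_c = 95·(1 − 82.6(p − 0.16)²) = 66.75 / 87.94 / 94.22 / 91.86 / 66.75 K` (exact: `66.7508, 87.9377,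
94.2153, 91.8612, 66.7508`) — the `p = 0.22` and `0.10` samples share one `T_c` by the parabola's symmetry
[cite: AlldredgeEtAl2008Bi2212GapEdgeScattering, Fig. 3 caption]. -/
theorem alldredge_doping_rows :
    95 * (1 - 82.6 * (allDopings 0 - 0.16) ^ 2) = 66.7508 ∧ 95 * (1 - 82.6 * (allDopings 1 - 0.16) ^ 2) = 87.9377 ∧
    95 * (1 - 82.6 * (allDopings 2 - 0.16) ^ 2) = 94.2153 ∧ 95 * (1 - 82.6 * (allDopings 3 - 0.16) ^ 2) = 91.8612 ∧
    95 * (1 - 82.6 * (allDopings 4 - 0.16) ^ 2) = 95 * (1 - 82.6 * (allDopings 0 - 0.16) ^ 2) := by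
  simp [allDopings]; norm_num

end Literature.MathematicalPhysics.QuantumLattice.GapMapStatistics

end
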